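import Mathlib
import HarnessLib
import HarnessLib.Audit
import Summits.KontsevichZagierPeriods.Statement
import HarnessLib.Audit.Status.Attr

/-!
Route: TerasomaMultiplication

# Route TerasomaMultiplication — Gauss multiplication inside the rules: n = 3 by the real
bi-elliptic involution of the Bolza box fibre; all n by torsion-freeness, prime sieve, integral
transposition

It suffices to show X = GammaHodgeSector ∧ CompleteModGammaSector — the Γ-HODGE FRAME of Conjecture
1, both conjuncts claimed as ranked
cruxes (unchanged since rev 7/9): every Deligne–Koblitz–Ogus Hodge-type identity ΠB(x_j,y_j) =
c·π^k·ΠB(x'_l,y'_l) between the cube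
representation and the (2k-ball × cube) representation is a KZ-equivalence (GammaHodgeSector, crux
5, decl shared verbatim with
MotivatedMoves), and Conjecture 1 holds for the calculus ENLARGED by those identities
(CompleteModGammaSector, crux 7, ranked LAST:
summit-implied, GPC-strength, the merge point with the summit-level routes; `closes` is a three-line
λ-term, certified native).
THIS ROUTE IS AN ALTERNATIVE DECOMPOSITION OF GammaHodgeSector (D-0019: separate route, shared
decl), realising card
terasoma-covering-gauss-multiplication. Its four Γ-sector deliverables, with the levers as they
stand after the opening night
(2026-08-16; every theorem named below is kernel-checked in the tree —
`Theorems/<Crux>/Negative/*.lean` accepted, or the committed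
crux workfiles `Cruxes/<Crux>/Disproof.lean`):
(M3) MULTIPLICATION AT n = 3 IS A WEIGHTED SCISSORS CONGRUENCE — NOW IN CLOSED FORM END TO END (crux
2 MultiplicationThree,
the tier-deciding crux; shared with MellinCoarea). LEVER: shear both sides over the common level u =
(1−v₁)(1−v₂) = σ₁σ₂σ₃ ∈ (0,1)
(s survives only as the spectator weight u^(s−1)); the box fibre is the genus-2 curve C_u : W³ =
v²(1−v)²(1−u−v) — a Bolza/D₁₂
curve (ShaskaVoelklein2001 §3 II, held and read), BI-ELLIPTIC with the REAL, ℚ-rational involution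
ι_u(v) = (1−u−v)/(1−v) whose
quotient is, on the nose over ℚ(u), the simplex's own level cubic E_u : w² = Q(a,u) := a²(3−a)² −
4ua (a = −(z−1)²/z,
z³ = v(1−v)/(1−u−v)). Three EXACT identities make the pair a chain of rules (1a)(1b)(2) in dimension
2, uniform in s, with every
map written down. (α) |ι′|·ψ∘ι = ψ̄ and (β) |∂a/∂v|/√Q = (ψ+ψ̄)/3 identically (ψ, ψ̄ the two box
densities
v^(−2/3)(1−v)^(−2/3)(1−u−v)^(−1/3), v^(−1/3)(1−v)^(−1/3)(1−u−v)^(−2/3)) — PROVED by the standing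
disprover
(Cruxes/MultiplicationThree/Disproof.lean §8 `bolza_involution_density`, `bolza_lever`,
`bolza_chart_deriv_ne_zero`; steps 0+(i)
CERTIFIED as move instances for every rational s > 0, §9 `boxRep_equivalent_sigmaBoxAvgRep`), giving
box ~ [Σ_neg = {0<u<1, a<0}, 3f], f := u^(s−1)/√Q. (γ) NEW THIS PASS (promote g2; Sketch.lean rc 0,
0 sorry, attached to
stmt-3598): the integer bookkeeping 3 = 2 + 1 needs NO torsion-translation formula and NO isogeny.
Translation by the 2-torsion
point (a₁,0) of E_u IS the Möbius involution μ₁(a) = (3−a₁)(a−a₁)/(2a+a₁−3) of the a-line (a₁(u) ∈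
(0,1) the root of
a(3−a)² = 4u; μ₁ swaps 0↔a₁, a₂↔a₃ by Vieta) and Q∘μ₁ = (μ₁′)²·Q EXACTLY —
`mobius_jacobian_identity`, a `ring` identity given
4u = a₁(3−a₁)² — so ONE rule-(2) move carries [Σ_neg, f] onto [{a₁ < a < b₁}, f], b₁ = μ₁(∞) =
(3−a₁)/2. THE CLICK: the point
(b₁, a₁, b₁) LIES ON the level cubic σ₁σ₂σ₃ = u, Σσ = 3 (`mirror_point_on_level`) — μ₁ sends the
flex ∞₊ to the σ₁ = σ₃ mirror
point — hence on the sheet σ₂ < σ₃ the arc {a₁ < a < b₁} is PRECISELY the image of the simplex cell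
M₃ = {σ ∈ Δ : σ₃ > σ₁, σ₃ > σ₂}
under the shear S(σ₁,σ₂) = (σ₁σ₂σ₃, σ₁) (Jacobian σ₁(σ₃−σ₂) = √Q, `shear_jacobian_sq`): ONE rule-(2)
move [M₃, g] ~ [{a₁<a<b₁}, f],
g := (σ₁σ₂σ₃)^(s−1); and the factor 3 is the CYCLIC symmetry of the simplex — the 3-torsion
translation of E_u acting LINEARLY
(affine, det 1, g invariant, `cyclic_invariance`): Δ ~ [M₃, 3g]. Whole chain: box ~Ψ~ [Σ_box,
u^(s−1)ψ] ~ι~ [Σ_box, u^(s−1)(ψ+ψ̄)/2]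
~∛-chart, 2 cells~ [Σ_neg, 3f] ~1b~ 3[Σ_neg, f] ~μ₁~ 3[{a₁<a<b₁}, f] ~S⁻¹~ 3[M₃, g] ~cyclic, 1a~ Δ:
≈ 14 instances of rules
(1a)(1b)(2). No Newton–Leibniz move, no complex sheet, no group ring, no division by an integer, and
no numerics-only step left
(the arc ratios 2/3 : 1 : 1/3 of kit j005071 are now a COROLLARY of the chain; the new pair's values
agree, num/value_check.py).
The two new moves are typed as rank-9 supports NegativeBranchToMaxCell ([Σ_neg, f] ~ [M₃, g]) and
SimplexToMaxCell (Δ ~ [M₃, 3g]);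
the lead's natural stubs BoxToNegativeBranch (steps 0–ii) and the glue MultiplicationThreeFromCells
elaborate in the same Sketch.
Two independent back-up lines keep kernel-checked first lemmas: level-annulus Green
(`Cruxes/MultiplicationThree/SketchIdeator2g2.lean`:
LevelCriticalValues, NodeIsA1, TwistedSliceOffSimplexPlane) and Terasoma's Betti transposition,
INTEGRAL with Θ₃ explicit (below).
(M) MULTIPLICATION FOR ALL n (crux 3 MultiplicationAccessible; OtsuboYamazaki2026 Thm 7.2 is exactly
this shape,
h(F_d^(n)⟨n⟩)^(α,…,α) ≅ ⊗_(χ^n=1,χ≠1) h(F_d^(2))^(α,χ), proof p. 20 READ). Three facts reshape it: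
(i) TORSION IS CLOSED —
FormalRep ⧸ relations is torsion-free (landed
`Theorems/MultiplicationAccessible/Negative/Core.lean`,
`mem_relations_of_nsmul_mem_relations`; `multiplicationAccessible_iff_upToTorsion`), so O–Y's
division by (n−1)! and every
"only N·(pair)" fear are moot; (ii) a PRIME SIEVE (lead line shifted-family-prime-sieve, 7
registered stubs, deep-refute: all
survive): the shifted family GM(n;x,s) := Π_(k<n) B(x+k/n,s) = n^(ns)·B(nx,ns)·Π_(0<j<n) B(js,s) is
MULTIPLICATIVE IN n inside the
rules by a cancellation-free glue (Dirichlet re-association = rotations on the associahedron of Beta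
words, products/reindexing
from the proved KZProductIdeal), the p = 2 rung is ONE rule-(2) bijection Φ(η) = (η₀η₁,
(1−η₀)(1+η₁)/(2(1−η₀η₁))) of the open
box onto itself (Lean-certified: `Cruxes/MultiplicationAccessible/DrefutePhiFacts.lean`, phi_bijOn,
det_phiDeriv), and the bridge
GM(n;1/n,s) ⇒ crux(n) is two Newton–Leibniz strips with monomial primitives + the Dirichlet chart —
so n = 4, 8, 16, … close with
ZERO unproved leans once GM(2) lands, and the residual is exactly GM(p;x,s) at odd primes p, 0 < x ≤
1/p; (iii) at a prime p
(x = 1/p is crux(p); p = 3 is crux 2) Terasoma's Betti transposition is INTEGRAL: H₁(C°, cusps; ℤ)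
is FREE of rank one over
ℤ[μ_d × μ_p] on the real arc (dessin of the Belyi map y^p: the group is simply transitive on edges),
hence
[q^!Z̄₀] = Θ_p·[γ^(p−1)] + ∂W_p + (chains in the cusp divisor) with Θ_p UNIQUE and computable by
character pairing — at p = 3,
Θ₃ = Σ_(i mod d, j mod 3)([(i,j)|(−i,j+2)] − [(i,j)|(−i,j+1)]), 6d terms, coefficients ±1 (Disproof
§7, kit certificate
j010553); the degree 2d of q is absorbed by rule (1b)
(`of_sub_nsmul_of_constMul_inv_mem_relations`). The route's own falsifier
(2) was RUN and does NOT bite.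
(C) BETA-CANCELLATION (crux 4): Beta classes are non-zero-divisors modulo the moves. Now SANDWICHED
by proved implications
KZ.PiCancellation (AyoubSpecialisation 0540) ≤ BetaCancellation ≤ summit
(`piCancellation_of_betaCancellation` via the four-move
chain [β(½,½)] ~ [π]; `betaCancellation_of_summit`), PROVED whenever one exponent is a positive
integer
(`betaCancellation_of_int_or_int`, one Newton–Leibniz move with primitive t^a(1−t)^b), open core =
both exponents non-integer,
reduced to (a mod 1, b mod 1); and shown LOAD-BEARING for the Γ-sector by a level-8 witness:
B(1/8,1/8)B(3/8,3/8)B(5/8,7/8) =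
½·B(1/8,3/8)B(1/8,5/8)B(3/8,7/8) have identical Γ-class vectors yet NO path of
symmetry/translation/Dirichlet/unit moves joins
the two words (drefute census: 0 isolated fibres for d ≤ 7, 4 at d = 8, 208 at d = 12) — equal class
vector gives only STABLE
equivalence w·z ≡ w'·z (Ext¹(ℚ/ℤ-cocycle) argument), so cancellation is exactly the seam, as the
thesis claimed.
(G) THE YAMAMOTO–DAS GAP (cruxes 5–6): the residue of GammaHodgeSector after multiplication +
reflection + translation +
Dirichlet is the 2-torsion H_N/S_N (ℤ/2 first at N = 12; its lattice input is a THEOREM of the tree,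
`KoblitzOgus.hodge_eq_combination_int`); its smallest instance DasGapTwelve, B(1/12,1/4) =
2^(−1/4)3^(3/8)√(1+√3)·B(1/4,1/4), has
an explicit dimension-ONE chain of rules (1a)(1b)(2) through the Picard curve v⁴ = t − t⁴ (Klein
lift t ↦ (1−t)/(1+2t), fold,
quotient by the companion involution onto the quartic twist V² = w³ − (3+2√3)w of y² = x³ − x,
lemniscatic normalisation):
THREE of its five registered stubs have LANDED
(`Theorems/TerasomaMultiplicationDasGapTwelveStub{CubeSubstitution,
InvolutionFold,TwistNormalisation}.lean`), two remain (the 2:1 quotient cell map, the B(1/4,1/4)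
normalisation).
Lean:
`Summit.KontsevichZagierPeriods.KontsevichZagierPeriods.Theses.TerasomaMultiplication.GammaHodgeSector
∧
Summit.KontsevichZagierPeriods.KontsevichZagierPeriods.Theses.TerasomaMultiplication.CompleteModGammaSector`

## Assembly
Provable now and certified native (glue.lean, 3 tactic lines, axioms
propext/Classical.choice/Quot.sound; unchanged since rev 7):
for rational r, r' of equal value, CompleteModGammaSector at H = relations (`le_rfl`) reduces [r] −
[r'] ∈ relations to the
Γ-Hodge pair differences lying in relations, and that hypothesis is GammaHodgeSector verbatim:
`exact h₂ _ le_rfl (fun … hval => h₁ … hval) r r' hr hr' hv`. Cruxes 2–4 and 6 are not antecedents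
of this implication: they
are the unconditional deliverables through which THIS route attacks the antecedent GammaHodgeSector
(two-layer plan), exactly as
SelbergAMGM / CyclesAsDomains / MotivatedMoves stage their own; crux 7 is the complement no Γ-sector
mechanism reaches, claimed so
that X decides the summit.

Rationale: WHY THIS LINE. Terasoma's diagram (Terasoma1995; Otsubo2023 App. = arXiv:2108.06754;
OtsuboYamazaki2026 §7.2 = arXiv:2402.06072
pp. 19–20, READ) — Kummer cover T: t^d = Πσ_j of S = {Σσ_j = n}, twisted Fermat X, and q : C^(n−1) →
T with C: x^d + y^n = 1,
σ_j = Π_i(1 − ζ_n^j y_i), t = Πx_i — proves Gauss multiplication for every n and d at once and its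
finite-field shadow COUNTS
(Otsubo's proof of Davenport–Hasse): the profile of a move sequence. On the de Rham side q^*ω_T is
an identity of algebraic forms
(q = DFT ∘ Vieta; at n = 3 the Jacobian is c₃(y₁−y₂), c₃ = ζ−ζ² = i√3, kernel-checked
`jacobian_dft_vieta`), so all content is
BETTI — and the opening night settled the Betti question this route was judged on: the transposition
is INTEGRAL (H₁(C°,cusps;ℤ)
free of rank one over ℤ[μ_d×μ_n] by the dessin of y^n; Θ₃ explicit; no torsion, no N·Z₀, no passage
through y = ∞ —
Cruxes/MultiplicationThree/Disproof.lean §7) and FormalRep ⧸ relations is TORSION-FREE (landed), so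
the recorded failure modes of
cruxes 2–3 are void and are replaced below by the real residual risks. For n = 3 the same fibration
over the level exposes a
cheaper and prettier lever than the covering itself: the REAL bi-elliptic involution of the genus-2
box fibre (a Bolza D₁₂
curve, ShaskaVoelklein2001 §3.2(II)) quotients it 2:1 onto the simplex's own level cubic and the
level-3 torsion does the integer
bookkeeping, turning MultiplicationThree into a weighted scissors congruence (rules 1+2, dimension
2) whose two non-classical
identities are already theorems. The second ingredient stays what re-deriving the old glue exposed:
O–Y invert motives twice
(p. 20 "since N is invertible … L ≅ N"), and inside an EFFECTIVE calculus the pure-Beta family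
reaches every other Beta-isation
of multiplication (0312, the Γ-form, the Koblitz–Ogus span) only through cancellation of a Beta
class — the typed crux
BetaCancellation, now sandwiched PiCancellation ≤ BetaCancellation ≤ summit and shown load-bearing
for the Γ-sector by isolated
Beta words at level 8. Imported areas: Chow motives of Fermat varieties and the Davenport–Hasse
dictionary; automorphisms of
genus-2 curves and the universal level-3 elliptic curve (the n = 3 lever); dessins / relative
homology of Fermat curves
(integrality); Koblitz–Ogus/Yamamoto/Das on integral Γ-monomial relations (O–Y §8 p. 22: "finding
all the integral relations
appears to be subtler … a future problem"). Versus neighbours: MellinCoarea shares crux 2 and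
foresaw "an isogeny over
ℚ(u,√−3), moving branch points" — the involution is a QUOTIENT over ℚ(u), two sheets, cut at the
ι-fixed point 1−√u;
FermatIsogeny reaches 0312 through an s = 1/9-specific CM divisor; CyclesAsDomains/MultivaluedCoV
through the Aoki–Shioda curve
on X_9²; SelbergAMGM only modulo cube roots; MotivatedMoves abstractly through André; none has
multiplication-for-all-n with
integrality proved, nor names the cancellation seam.

RANKED CRUXES. #2 MultiplicationThree (crux; TIER-DECIDING; shared with MellinCoarea, stmt-3598) — n
= 3 of the pure family,
every rational s > 0: [(0,1)², v₁^(−2/3)(1−v₁)^(s−1)v₂^(−1/3)(1−v₂)^(s−1)] ~ [Δ = {σ₁,σ₂>0,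
σ₁+σ₂<3}, g = (σ₁σ₂(3−σ₁−σ₂))^(s−1)]
(B(1/3,s)B(2/3,s) = 3^(3s−1)Γ(s)³/Γ(3s); value equality PROVED, `value_eq`, landed ValueEq.lean;
crux ⇔ pinned form
`multiplicationThree_iff_pinned`; true at s = 1 by two rule-(2) moves `multiplicationThree_at_one`;
additivity alone never
suffices `not_multiplicationThreeByAdditivity`). ATTACK (line bolza-involution-real-quotient, CLOSED
FORM END TO END since this
pass; rules (1a)(1b)(2) only, dimension 2, uniform in s, ≈ 14 move instances; f = u^(s−1)/√Q, Q =
a²(3−a)² − 4ua,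
a₁ < a₂ < a₃ the roots of a(3−a)² = 4u, b₁ = (3−a₁)/2): Step 0 shear Ψ(v₁,v₂) = ((1−v₁)(1−v₂), v₁):
box ~ [Σ_box, u^(s−1)ψ] —
CERTIFIED (`box_shear_move`). Step (i) involution ι_u: [Σ_box, u^(s−1)ψ] ~ [Σ_box, u^(s−1)(ψ+ψ̄)/2]
— CERTIFIED
(`bolza_involution_move`, `boxRep_equivalent_sigmaBoxAvgRep`). Step (ii) chart a(u,v) = −(z−1)²/z,
z³ = v(1−v)/(1−u−v), on the
two cells v ≶ 1−√u, each injective onto Σ_neg = {0<u<1, a<0}: ~ [Σ_neg, 3f] — Jacobian identity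
PROVED (`bolza_lever`),
monotonicity PROVED (`bolza_chart_deriv_ne_zero`); open = the two rule-(2) instances (semialgebraic
real cube root, integrability
transport). Step (iii), EXPLICIT THIS PASS (promote-g2 Sketch.lean rc 0, 0 sorry; evidence on
stmt-3598): (a) [Σ_neg,3f] ~ 3[Σ_neg,f]
(1b ×2); (b) 2-TORSION MÖBIUS MOVE μ₁(a) = (3−a₁)(a−a₁)/(2a+a₁−3) = translation by (a₁,0) (swaps
0↔a₁, a₂↔a₃), an involution,
with Q(μ₁a)·(2a+a₁−3)⁴ = 9(3−a₁)²(a₁−1)²·Q(a) EXACTLY (`mobius_jacobian_identity`, `ring`;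
`hasDerivAt_mobius`), i.e.
|μ₁′|/√Q∘μ₁ = 1/√Q: ONE rule-(2) move [Σ_neg,f] ~ [{a₁<a<b₁},f], Q(b₁) = 9(3−a₁)²(a₁−1)²/16 > 0
(`Q_at_mirror_pos`); (c) THE
CLICK: (b₁,a₁,b₁) lies ON σ₁σ₂σ₃ = u, Σσ = 3 (`mirror_point_on_level`), so on the sheet σ₂<σ₃ the
arc {a₁<a<b₁} — from
(a₁,b₁,b₁) [σ₂=σ₃] through (b₂,b₂,a₂) [σ₁=σ₂, b₂ = (3−a₂)/2] to (b₁,a₁,b₁) [σ₁=σ₃] — is exactly the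
shear image of the simplex cell
M₃ = {σ₃ > σ₁, σ₃ > σ₂}: ONE rule-(2) move [M₃,g] ~ [{a₁<a<b₁},f] by S(σ₁,σ₂) = (σ₁σ₂σ₃, σ₁),
Jacobian σ₁(σ₃−σ₂) = √Q
(`shear_jacobian_sq`); (d) Δ ~ [M₁,g]+[M₂,g]+[M₃,g] ~ 3[M₃,g] ~ [M₃,3g] by the CYCLIC
map (σ₁,σ₂) ↦ (σ₂, 3−σ₁−σ₂) (affine, det 1, g invariant, `cyclic_invariance`) — the 3-torsion
translation acting linearly. So box ~ [Σ_neg,3f] ~ 3[{a₁<a<b₁},f] ~ 3[M₃,g] ~ Δ; no P₃-chord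
formula, no isogeny, no
numerics-only step (the ratios 2/3 : 1 : 1/3 are a corollary). Typed this pass as rank-9 supports:
NegativeBranchToMaxCell
((b)+(c): [Σ_neg,f] ~ [M₃,g], size M) and SimplexToMaxCell ((d), provable now); BoxToNegativeBranch
(steps 0–ii) and the glue
MultiplicationThreeFromCells (transitivity + 1b-scaling + existence of the Σ_neg rep by transported
integrability) elaborate in
the Sketch and are left to the lead's skeleton. [difficulty: L, provable now] (why it might fail:
formal residue only — a₁(u)
(simple root in (0,1)) and the real cube root as ℚ-semialgebraic C¹ rule-(2) data; integrability of
u^(s−1)/√Q on Σ_neg (fibre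
integral log-singular at u → 0, u^(s−1)-integrable); a slip lengthens the chain, cannot kill it.
Back-ups with kernel-checked first
lemmas stay on file: conifold-annulus-green (rule 3 twice per cell) and the integral Betti
transposition (Θ₃ explicit).)
[OtsuboYamazaki2026 Thm 7.2 (held; pp. 19–20 read); ShaskaVoelklein2001 §3 II (held, read);
DeinesEtAl2014 Thm 20; AndrewsAskeyRoy1999 §1.5 pp. 30–31 (Liouville 1855, read), Thm 1.8.1;
Cassels1991 §§7–8 (iii) (held; y² = quartic with a rational point, translations);
KontsevichZagier2001 §1.2; in-tree
Cruxes/MultiplicationThree/{Disproof.lean §§7–9, Ideas/bolza-involution-real-quotient.md},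
promote-g2 Sketch.lean]
#3 MultiplicationAccessible (crux, stmt-12305) — the pure-Beta family for every m ≥ 1 (n = m+1),
rational s > 0: box rep of
Π_(k≤m) B(k/n,s) ~ simplex rep ∫_(σ_j>0, Σσ_j<n)(Πσ_j·(n−Σσ_j))^(s−1) (n^(ns−1)Γ(s)^n/Γ(ns); O–Y Thm
7.2 inside the rules).
STATE: torsion-free quotient landed (`mem_relations_of_nsmul_mem_relations`;
`multiplicationAccessible_iff_upToTorsion`: "up to
N" is EQUIVALENT to the crux); s = 1, m = 1 is one move (`at_one_one`). ATTACK = the lead's prime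
sieve: GM(n;x,s) =
Π_(k<n)B(x+k/n,s) = n^(ns)B(nx,ns)Π_(0<j<n)B(js,s) is multiplicative in n inside the rules
(betaReassoc = two rule-2 moves through
the simplex; multiplicativityGlue = block reindexing + associahedron rotations + proved
KZProductIdeal, cancellation-free);
GM(2) = dupSymmetrise (Kummer η², swap, 1b, torsion-freeness) + dupPhi (ONE rule-2 bijection Φ(η) =
(η₀η₁,
(1−η₀)(1+η₁)/(2(1−η₀η₁))) of the open box, Lean-certified phi_bijOn/det_phiDeriv); bridge
GM(n;1/n,s) ⇒ crux(n) = two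
Newton–Leibniz strips (primitives −(1−t)^s/s, −(1−u)^(ns)/(ns)) + the Dirichlet chart (constant
n^(ns−1) tight,
`not_unitSimplexVariant`). So n = 2^k closes with zero unproved leans; residual = GM(p;x,s) at odd
primes p, 0 < x ≤ 1/p. At
x = 1/p this is crux(p) (p = 3: the Bolza chain; general p: the transfer q^!Z̄₀ in (C°)^(p−1),
INTEGRAL by the dessin argument
verbatim, Θ_p by character pairing, deg q absorbed by rule 1b
`of_sub_nsmul_of_constMul_inv_mem_relations`). [difficulty: XL]
(why it might fail: retriage line.) [OtsuboYamazaki2026 Thm 7.2, p. 20; Otsubo2023; arXiv:1901.03400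
(Euler E421);
AndrewsAskeyRoy1999 Thm 1.5.2; KontsevichZagier2001; in-tree
Cruxes/MultiplicationAccessible/{Disproof.lean, PICKED.md,
DrefuteShiftedFamilyPrimeSieve.md, DrefutePhiFacts.lean}]
#4 BetaCancellation (crux, stmt-13633) — Beta classes are NON-ZERO-DIVISORS modulo the moves,
import-free two-term pinned form
(q = β(a,b)⊗r, q' = β(a,b)⊗r'; q ~ q' → r ~ r'), equivalent to the ideal form by proved
KZProductIdeal facts. STATE (Disproof +
landed Negative/{KernelForm,LoadBearing,IntegerExponents,PiLink*}.lean): KZ.PiCancellation ≤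
BetaCancellation ≤ summit
(`piCancellation_of_betaCancellation` via the four-move chain [β(½,½)] ~ [π]); value-blind descent
impossible (the odd kernel
2t−1 does NOT cancel); primitive criterion: a kernel with a ℚ-semialgebraic primitive cancels iff
its integral ≠ 0 (ONE
Newton–Leibniz move over any base), hence PROVED when a ∈ ℕ⁺ or b ∈ ℕ⁺
(`betaCancellation_of_int_or_int`); OPEN CORE = a ∉ ℤ ∧
b ∉ ℤ, a function of (a mod 1, b mod 1), = PiCancellation on the anti-diagonal given Euler
reflection (3383). ATTACK (lead line
dirichlet-companion-to-pi, 4 stubs): multiply by the companion β(a+b,1−b), ONE Dirichlet contraction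
β(a+b,1−b)⊗β(a,b) ~
(1/a)β(b,1−b) in dimension 2, reflection to [π], then PiCancellation (0540): ends `blocked-on 0540`
unless 0540 falls — the crux
IS effective-period injectivity at [π]-strength. [difficulty: open-problem] [HuberWustholz2022 App.
A pp. 199–200 READ;
OtsuboYamazaki2026 p. 20; Ayoub2015; KontsevichZagier2001; HuberMullerStachPeriods2017 Ch. 13]
#5 GammaHodgeSector (crux, stmt-3742; verbatim the MotivatedMoves crux) — Deligne1982HodgeCycles Thm
7.18 in Beta form as a
∀-statement of the rules calculus. Decomposed HERE as: the Koblitz–Ogus lattice theorem (IN THE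
TREE,
`KoblitzOgus.hodge_eq_combination_int`: Hodge type ⇒ n₀·(class vector) ∈ ℤ-span of reflection and
distribution vectors) +
standard relations as chains (multiplication = crux 3, reflection = 3383,
translation/symmetry/Dirichlet/unit factors = rules
1–3 with monomial primitives, the 2k-ball = β(½,½)^k) + BetaCancellation to pass from STABLE
equivalence of Beta words (all that
equal class vectors give — level-8 isolated words) to equivalence + halving of n₀ (torsion-freeness)
+ one chain per class of the
Yamamoto–Das gap H_N/S_N (ℤ/2 at N = 12, 15, 20, 21, 24, 28, 30; smallest = crux 6). Lead line
koblitz-ogus-halving (7 stubs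
over KZ.FormalPeriodRing; hardest = lattice lift/kernel algebra; one named non-constructive input,
uniqueness of positive n-th
roots in the formal period ring, as a hypothesis). [difficulty: XL] [Deligne1982HodgeCycles Thm
7.15/7.18 (held, LNM 900);
KoblitzOgus1979; Das2000; OtsuboYamazaki2026 §8 p. 22; doi:10.1016/s0021-9800(66)80018-2; Aoki1987]
#6 DasGapTwelve (crux, stmt-13215) — the smallest gap identity as a dimension-1 LINEAR pair [∫₀¹
x^(−11/12)(1−x)^(−3/4)] ~
[∫₀¹ c₀(x(1−x))^(−3/4)], c₀ = 2^(−1/4)3^(3/8)√(1+√3) (landed: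
`Lattice12.gapClass_not_mem_standardSpan`, `c₀_pow_four : c₀⁴ =
9+6√3`). ATTACK (lead line picard-involution-quotient, rules 1a/1b/2, dimension ONE): x = t³ onto
the Picard curve v⁴ = t − t⁴;
fold by the real involution τ₊ : t ↦ (1−t)/(1+2t); quotient by the companion involution τ₋ onto the
unbounded real component of
the quartic twist V² = w³ − (3+2√3)w, w² = (1+t+t²)/(t(1−t)); untwist with the exact constant
4√3(√3+1)D^(−1/4) = 4√2·c₀;
lemniscatic normalisation of B(1/4,1/4). THREE OF FIVE STUBS LANDED (StubCubeSubstitution,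
StubInvolutionFold,
StubTwistNormalisation); open: the 2:1 quotient cells (explicit inverse t = [(x²−1) ±
√((x²−3)²−12)]/(2(1+x²))) and the
B(1/4,1/4) split/fold. [difficulty: L, moving] [Das2000; KoblitzOgus1979; Deligne1982HodgeCycles;
Gross1978 (Chowla–Selberg);
in-tree Cruxes/DasGapTwelve/{Disproof.lean, PICKED.md, Lines/picard-involution-quotient.lean}]
#7 CompleteModGammaSector (crux, stmt-14233) — Conjecture 1 for the Γ-ENLARGED calculus (subgroup
form; Sketch-checked equivalent
to MotivatedMoves' item 10378; summit-implied): every additive subgroup H ⊇ relations containing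
every Γ-Hodge pair difference
contains [r] − [r'] for all rational r, r' of equal value. Every non-Γ sector at once, GPC strength,
no mechanism of this line;
claimed so that X decides the summit, ranked LAST, merge point with NoriTransfer / Grothendieck /
the kernel routes.
[difficulty: open-problem] [KontsevichZagier2001; HuberMullerStachPeriods2017 Ch. 13; Ayoub2014;
Andre2004 Ch. 23; Brown2012]
Supports (#9): TriplicationAccessible (0312 = crux 2 + ReflectionThird + crux 4 via
TriplicationFromMultiplication, ring
derivation checked to 1e-13); ReflectionThird (instance a = 1/3 of 3383, sorry-free glue attached);
DuplicationAllExponents (n = 2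
rung, four moves); TriplicationFromMultiplication (the cancellation glue); NEW:
NegativeBranchToMaxCell and SimplexToMaxCell (the
explicit step (iii) of crux 2, values checked, certificates kernel-checked).

TWO-LAYER PLAN. Foreseen glued splits (NOT filed as --split: lines live in Cruxes/<Decl>/Lines under
the crux protocol and the
parent cruxes stay whole while their chains run): MultiplicationThree ⇐ BoxToNegativeBranch (steps
0–ii; line stub) →
NegativeBranchToMaxCell (support, filed) → SimplexToMaxCell (support, filed) → MultiplicationThree
(glue MultiplicationThreeFromCells:
transitivity, 1b-scaling [A,f] ~ [B,g] ⇒ [A,3f] ~ [B,3g], existence of the Σ_neg representation;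
elaborates). MultiplicationAccessible ⇐ ShiftedMultiplicativity → ShiftedDuplication (GM(2;x,s)) →
OddPrimeShifted (GM(p;x,s),
0 < x ≤ 1/p) → MultiplicationAccessible (glue = strip bridge + Dirichlet chart) — the lead's
registered skeleton. GammaHodgeSector
⇐ StandardSpanAccessible (crux 3 + 3383 + crux 4 + translation/Dirichlet/unit chains +
`hodge_eq_combination_int` + halving) →
DasGapPairs (one linear pair per class of H_N/S_N; crux 6 first; general item once Das2000,
acq-01271, is compared with
num/gapgroup.py) → GammaHodgeSector.

KILL CRITERIA. (a) A refutation of MultiplicationThree — an additive invariant of FormalRep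
vanishing on the four move sets and
separating the pinned pair — closes the route `refuted:MultiplicationThree` AND refutes the summit
(`multiplicationThree_of_summit`);
after Disproof §§7–9 no candidate survives (an additive, order-continuous invariant of rules 1+2 is
a multiple of evaluation).
(b) LINE-LEVEL (the rev-15 CAS test is SETTLED in closed form: 2-torsion move = Möbius μ₁ with exact
Jacobian identity,
3-torsion bookkeeping = the simplex's cyclic symmetry): what can still go wrong is formal — if rule
(2) as formalised resists the
implicit-but-semialgebraic data a₁(u), ∛ (InjOn / HasFDerivWithinAt / IsSemialgebraicMapOn, all
true), the same maps are re-cut into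
more cells; only if NO dimension-2 chain is accepted does the crux fall back to the annulus/Betti
lines (rule 3, dimension 3) — the
crux changes line, the route stands. (c) ¬BetaCancellation refutes the
summit through the kernel form and moots TriplicationFromMultiplication and crux 5's
koblitz-ogus-halving line; cruxes 2, 3, 6
stand; ¬PiCancellation (0540) ⇒ ¬BetaCancellation. (d) A proof that some GM(p;x,s), x ≠ 1/p, is
unreachable without cancellation
does not refute crux 3 (x = 1/n only) but confines the sieve to n = 2^k·(primes done directly). (e)
GammaHodgeSector proved by
MotivatedMoves' André engine supersedes crux 5 only; ¬CompleteModGammaSector is ¬summit and closes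
every route of the sub. The old
criterion "[Z₀] ∉ ℤ[G]·[γ²] / only N·Z₀" is RETIRED: decided false by Disproof §7 and by
torsion-freeness.

NOT DECOMPOSED YET. BoxToNegativeBranch and the glue MultiplicationThreeFromCells (typed and
elaborating; left to the lead's skeleton on 3598); Θ_p, W_p for p ≥ 5 and the tool lemmas
"finite maps act by rule 2 on injectivity cells" (MultivaluedCoV.SheetTransfer, stmt-2877) and
"Stokes on a semialgebraic cell
for a closed algebraic form = Newton–Leibniz moves" (attached with --supports when a Betti line is
picked; not needed by the
Bolza line); the general DasGapPairs item beyond N = 12 (representatives: N = 15: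
[2/15]−[1/5]−[4/15]+[1/3]; N = 20:
[7/20]−[2/5]−[9/20]; all LINEAR pairs); StandardSpanAccessible as a typed item; GM(p;x,s) as a route
item (it is a registered STUB
of crux 3's lead; `promote-stub` only if the lead parks on it). Crux 7 is left whole.

CHEAPEST FALSIFIER. DONE and PASSED: (0) exact gap computation behind cruxes 5–6 (re-run
independently by refuter g45-43, own
HNF/Smith code; c₀ from Vidūnas' Γ(1/12) to 2e-16); (1) ring bookkeeping of
TriplicationFromMultiplication (1e-13), family
n = 2..6 (1e-15); (2) THE ROUTE'S OWN KILL OF CRUX 2, run by the standing disprover (kit j010553: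
explicit roots, all 2d sheets,
d ∈ {2,3,4,5,9}): Θ integral to 1.5e-8 = closed form, relative-Stokes test exact — does NOT bite;
(3) the Bolza line's killers
(kit j005071, 30 digits): K = |∂a/∂v|/(√Q(ψ+ψ̄)) CONSTANT = 1/3 at 25 points, spread ≤ 1.6e-30 (now
a theorem); torsion ratios
2/3 : 1 : 1/3 at five levels; I(u) = (2π/√3)₂F₁(1/3,2/3;1;1−u) to 9e-12; (4) annulus line: period
ratio ∮_Γc ω/∮_Oc ω =
−1.000000000 at six levels, windings −1, max|arg σ_j| ≤ 0.167π < π/3; (5) sieve: Φ bijection +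
Jacobian Lean-certified, all
seven stub values to ≤ 1e-12. (6) THIS PASS — the rev-15 'NEXT' item DONE in closed form and PASSED:
translation by (a₁,0) = Möbius μ₁,
Q∘μ₁ = (μ₁′)²Q kernel-checked; μ₁(−∞,0) = (a₁,b₁) with (b₁,a₁,b₁) on the level cubic and a₁ < b₂ <
b₁ < a₂; numerically
(num/mobius_check.py, u ∈ {0.2, 1/3, 0.5, 0.7, 0.9}): identities to 1e-15, arc ratios L₋ : half-oval
: L₊ = 2 : 3 : 1 and ∫_(a₁)^(b₁) = 2L₊ to 8 digits; the NEW PAIR's values agree (num/value_check.py,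
s = 1/2, 1, 2).
NEXT: nothing cheaper is left at kit level for crux 2 — the next test is the Lean instantiation of
rule (2) with a₁(u)
(NegativeBranchToMaxCell). Crux 4: nothing cheaper than 0540; crux 7: nothing cheaper than the
summit's invariant hunt (Neg).

NUMBERS. B(1/3,s)B(2/3,s) = 3^(3s−1)Γ(s)³/Γ(3s): 111.0928748424 (s = 1/9), 24.1402508051 (2/7),
2.4829585812 (5/3). 0312:
22.6371282948; L·A = 2514.8236604482. c₃ = i√3, c₃² = −3; Θ₃: 6d terms ±1; deg q = 2d. Bolza: K =
1/3 exactly; arc ratios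
2/3 : 1 : 1/3 (corollary); ι-fixed point 1−√u; μ₁: det = 3(3−a₁)(a₁−1), Q(b₁) = 9(3−a₁)²(a₁−1)²/16;
u = 1/2: a₁ = 2−√3,
a₂ = 2, a₃ = 2+√3, b₁ = (1+√3)/2, b₂ = 1/2, Q(b₁) = 9/4, ∫_(Σ_neg) da du/√Q = 1.5000 = 4.5/3 (s =
1); D₁₂ locus 4v−u²+110u−1125 = 0 (Shaska–Völklein's (u,v)). Annulus: period ratio −1 at six
levels; shadow gaps 0.0077…0.164. Sieve: det DΦ = (η₀+η₁)/(2(1−η₀η₁)). Level-8 isolated words: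
126.6150832829734 = ½·253.2301665659468.
Gap group: ℤ/2 at N = 12, 15, 20, 21, 24, 28, 30 (N ≤ 30); c₀ = 2.0984921908459913, c₀⁴ = 9+6√3, D =
3+2√3. Items: 13 (crux 6 at
ranks 2–7, support 6, assembly 1).

DEFINITION REQUESTS. None (KZ.IntegralRep / Equivalent / FormalRep / relations exist; the route file
imports only the Statement;
needs-fact: none — every fact a line uses is PROVED in the tree: GaussMultiplication.real_formula,
KoblitzOgus.hodge_eq_combination_int,
torsion-freeness, KZProductIdeal). Literature wanted, blocking no typed item: Das2000 (acq-01271);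
Terasoma1995 (acq-02267) and
Gross1978 (acq-04653) for citation hygiene — the levers of cruxes 2, 3, 6 rest on HELD texts
(arXiv:2402.06072, 2108.06754,
math/0107142, 1412.6906, 1901.03400; AndrewsAskeyRoy1999; Deligne LNM 900; HuberWustholz2022; K–Z
2001) and kernel-checked files.

Novelty: Delta in one sentence: the route no longer bets on transposing a printed motivic proof but on two
mechanisms absent from the
literature and from the other 80 theses of the sub — a REAL bi-elliptic quotient turning Gauss
triplication into a weighted
scissors congruence of rules 1+2, and the proved integrality/torsion-freeness that makes
"multiplication for all n inside the
rules" a statement about explicit chains rather than about ℚ-motives — with the cancellation seam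
(crux 4) now located exactly
(PiCancellation ≤ BetaCancellation ≤ summit; integer exponents proved).
(b′) NEW THIS PASS, for the n = 3 bookkeeping: two classical objects used in a way absent from every
text searched — the
2-torsion translation of a genus-1 double cover of the a-line as the Möbius involution pairing the
branch points {0,a₁,a₂,a₃}
(Cassels1991 §8 (iii) context), with its rule-(2) Jacobian identity Q∘μ₁ = (μ₁′)²Q proved as a ring
identity, and the 3-torsion
translation realised as the CYCLIC symmetry of the Dirichlet simplex; the weld (b₁,a₁,b₁) ∈ E_u is
an identity nobody needed
before because nobody computed inside the rules. Nearest classical move: Liouville's 1855 cyclic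
substitution (AndrewsAskeyRoy1999
§1.5 pp. 30–31, READ this pass) — but on Γ-integrals with e^(−t), closed by an ODE in the parameter,
not by finitely many
algebraic moves (its de-exponentialisation is the separate crux idea liouville-flat-twisted-pencil,
rule 3).
Nearest prior art FOUND. (a) For "Gauss multiplication as one co  [refs: 2402.06072, math/0107142, 1412.6906, arxiv:2402.06072, arxiv:math/0107142, arxiv:1412.6906, Cassels1991, AndrewsAskeyRoy1999, Terasoma1995, Otsubo2023, OtsuboYamazaki2026, ShaskaVoelklein2001, DeinesEtAl2014, Das2000, Gross1978, Aoki1987, HuberWustholz2022]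

Barriers (technique_class: real-bielliptic-quotient betti-transposition prime-sieve): - technique_class: real-bielliptic-quotient betti-transposition prime-sieve
- Literature.Barriers.KontsevichZagierPeriods.noSemialgebraicPrimitive_inv_sub_two (Ayoub Rem. 1.2 /
Cresson–Viu-Sos §2.1) and
algebraicPrimitivesObstructionNarrow: EVADED, and the evasion is now sharp. The Bolza line for crux
2 contains NO Newton–Leibniz
move at all (rules 1a/1b/2 only; the level u is a coordinate, nothing is integrated out). The
disprover's Chebyshev instance
(Disproof 6d) shows the barrier DOES bite every "Fubini-first" line in dimension 2 — ∫
v^(−1/3)(1−v)^(s−1) dv is algebraic iff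
s ∈ ℕ — which is exactly why the chain changes variables non-trivially instead; crux 3's sieve uses
Newton–Leibniz only with
MONOMIAL primitives −(1−t)^s/s, t^x(1−t)^y (translations, strips); the Betti/annulus back-up lines
use rule 3 only on integrands
that are by birth the partial derivatives of the algebraic coefficients of a closed form, in
dimension 3 (the barrier's own
"add variables" escape). Crux 4's open core is precisely where the barrier bites (no semialgebraic
primitive of t^(a−1)(1−t)^(b−1)
for a, b ∉ ℤ: `kernelCancellation_iff_of_primitive`), which is why it is typed as a crux and not
hidden in a chain.
- Literature.Barriers.KontsevichZagierPeriods.cressonViuSos_prop_3_2 (semialgebraic Hauptvermutung: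
no global semialgebraic
homeomorphism without scissors): not engaged — every line DISSECTS (crux 2: two ι-halves, two
∛-chart cells, one Möbius cell, three cyclic cells M₁, M₂, M₃ — every map

History (route lifecycle, newest last):
- 2026-08-15T19:49:41Z · rev 4: restated BetaCancellation (stmt-KontsevichZagierPeriods-12306) — cone repair (rrepair, D-0023 guardrail): BetaCancellation restated in the import-free TWO-TERM form over KZCalculus (q ~ q' → r ~ r' for q, q' pinned as Beta-ke (planner-rrepair-KontsevichZagierPeriods-Teraso-846b146b-0)
- 2026-08-16T02:19:14Z · AUTO-CRUX: 1 conjecture-grade item(s) promoted to crux (GammaSectorComplete) — refuter vetting / tiering apply (operator:999:1362873)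
- 2026-08-16T03:09:24Z · rev 9: restated Assembly (stmt-KontsevichZagierPeriods-10444) — route-choice (a): the avowed complement is now CLAIMED as crux 7 CompleteModGammaSector (subgroup form of stmt-10378; equivalence + summit-implication kernel-ch (planner-rchoice-KontsevichZagierPeriods-Teraso-83da79da-0)
- 2026-08-16T03:09:24Z · rev 9: dropped GammaSectorComplete — route-choice (a): the avowed complement is now CLAIMED as crux 7 CompleteModGammaSector (subgroup form of stmt-10378; equivalence + summit-implication kernel-ch (planner-rchoice-KontsevichZagierPeriods-Teraso-83da79da-0)
- 2026-08-16T06:48:08Z · rev 23: restated GammaHodgeFromRelators (stmt-KontsevichZagierPeriods-14859) — route-repair (unused-crux), step 2: wire the glue INTO the deciding theorem. closes now takes MultiplicationAccessible, BetaCancellation, DasGapTwelve, GapSecto (planner-rrepair-KontsevichZagierPeriods-Teraso-e1efbcf7-0)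
- 2026-08-16T06:50:31Z · rev 24: restated GammaHodgeFromRelators (stmt-KontsevichZagierPeriods-14921) — route-repair (unused-crux), step 3 = settle on the crux-only shape: closes reverted to (h₁ : GammaHodgeSector) (h₂ : CompleteModGammaSector) (rev-23 closes took (planner-rrepair-KontsevichZagierPeriods-Teraso-e1efbcf7-0)
- 2026-08-23T19:49:47Z · DORMANT — reconciler: no traction for 6.2 d (last activity item-evidence-added at 2026-08-17T14:26:07Z); parked, not closed — `ledger route dormant route-KontsevichZagier (operator:999:3129422)
- 2026-08-30T06:27:53Z · REACTIVATED — reconciler: reactivated — activity item-evidence-added at 2026-08-30T05:32:51Z after parking at 2026-08-23T19:49:47Z (operator:999:2889205)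

sub-problem: KontsevichZagierPeriods · status: open · opened planner-plancard-KontsevichZagierPeriods-Kont-ff3d1b52-g2-0 2026-08-15T18:52:40Z · rev 25 · ledger route-KontsevichZagierPeriods-TerasomaMultiplication
GENERATED by the gate from the ledger (D-0016/17). Provers cite these decls: `theorem foo : Summit.KontsevichZagierPeriods.KontsevichZagierPeriods.Theses.TerasomaMultiplication.<Decl> := …` in Summits/KontsevichZagierPeriods/KontsevichZagierPeriods/Theorems/<Name>.lean.
-/

namespace Summit.KontsevichZagierPeriods.KontsevichZagierPeriods.Theses.TerasomaMultiplication

open scoped BigOperators Topology Manifold Classical MeasureTheory ProbabilityTheory Matrix InnerProductSpace ComplexConjugate ContinuousMap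
open Filter Set Function TopologicalSpace MeasureTheory

attribute [summit_statement] _root_.KontsevichZagierPeriods

open Literature Periods

/-- item stmt-KontsevichZagierPeriods-3742 · crux · rank 5 · open · by planner
why it might fail: Equal Γ-class vectors give only STABLE equivalence of Beta words (level-8 isolated words): the line needs BetaCancellation (open) plus one new correspondence per Yamamoto–Das class (ℤ/2 at N = 12, 15, 20, …; only N = 12 has a chain); one Neg-type invariant separating a pair kills it and the summit.
sources: Deligne1982HodgeCycles, KoblitzOgus1979, Das2000, OtsuboYamazaki2026, doi:10.1016/s0021-9800(66)80018-2, Aoki1987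
[crux] Γ-HODGE SECTOR (Deligne1982HodgeCycles Thm 7.18 in beta form, as a ∀-statement of the RULES
calculus). For positive non-integer rationals (x_j,y_j)_(j<N), (x'_l,y'_l)_(l<N') with the
Hodge-type condition Σ_j(⟨ux_j⟩+⟨uy_j⟩−⟨u(x_j+y_j)⟩) − Σ_l(…) = k for every u ≥ 1 coprime to all
denominators (decidable; Deligne: then ΠB(x_j,y_j) = c·π^k·ΠB(x'_l,y'_l) with c real algebraic), the
cube rep [(0,1)^N, Π t_j^(x_j−1)(1−t_j)^(y_j−1)] and the rep [unit 2k-ball × (0,1)^N', c·k!·Π(…)]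
are KZ-equivalent whenever their values agree (value equality and algebraicity of c are hypotheses:
no transcendence in the Lean proof). Predicted by MotivatedTransfer + André 0.6.2 (Fermat motives
lie in the tensor category of abelian varieties) with NO algebraic cycle needed; decisive range N+N'
≥ 4 with composite denominators, where the Deligne classes on F_d^(N+N') are not known algebraic
(Shioda1979HodgeFermat, Aoki1987) and the only other derivations square the identity first (Das2000;
AndersonBrownawellPapanikolas2004 §1.1.6) or detour through Γ = exponential periods (route
ExpConservative). Contains Neg's triplication pair (stmt-0311/0312) at N=2, N'=0, k=1. [difficulty:
XL] -/
@[route_item "route-KontsevichZagierPeriods-TerasomaMultiplication", crux]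
def GammaHodgeSector : Prop :=
  ∀ (N N' k : ℕ) (x y : Fin N → ℚ) (x' y' : Fin N' → ℚ) (c : ℝ), (∀ j, 0 < x j ∧ 0 < y j ∧ Int.fract (x j) ≠ 0 ∧ Int.fract (y j) ≠ 0) → (∀ l, 0 < x' l ∧ 0 < y' l ∧ Int.fract (x' l) ≠ 0 ∧ Int.fract (y' l) ≠ 0) → (∀ u : ℕ, 0 < u → (∀ j, Nat.Coprime u (x j).den ∧ Nat.Coprime u (y j).den) → (∀ l, Nat.Coprime u (x' l).den ∧ Nat.Coprime u (y' l).den) → ((∑ j, (Int.fract ((u : ℚ) * x j) + Int.fract ((u : ℚ) * y j) - Int.fract ((u : ℚ) * (x j + y j)))) - ∑ l, (Int.fract ((u : ℚ) * x' l) + Int.fract ((u : ℚ) * y' l) - Int.fract ((u : ℚ) * (x' l + y' l)))) = (k : ℚ)) → IsAlgebraic ℚ c → ∀ (r : Literature.NumberTheory.Transcendental.KZ.IntegralRep N) (r' : Literature.NumberTheory.Transcendental.KZ.IntegralRep (2 * k + N')), r.domain = {t | ∀ j, t j ∈ Set.Ioo (0:ℝ) 1} → Set.EqOn r.integrand (fun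 t => ∏ j, (t j) ^ ((x j : ℝ) - 1) * (1 - t j) ^ ((y j : ℝ) - 1)) r.domain → r'.domain = {z | (∑ i : Fin (2 * k), (z (Fin.castAdd N' i)) ^ 2) < 1 ∧ ∀ l : Fin N', z (Fin.natAdd (2 * k) l) ∈ Set.Ioo (0:ℝ) 1} → Set.EqOn r'.integrand (fun z => c * (k.factorial : ℝ) * ∏ l, (z (Fin.natAdd (2 * k) l)) ^ ((x' l : ℝ) - 1) * (1 - z (Fin.natAdd (2 * k) l)) ^ ((y' l : ℝ) - 1)) r'.domain → r.value = r'.value → Literature.NumberTheory.Transcendental.KZ.Equivalent r r'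

/-- item stmt-KontsevichZagierPeriods-14233 · crux · rank 7 · open · by planner
why it might fail: It is Conjecture 1 for all non-Γ periods at once (MZV/mixed Tate, non-CM elliptic, modular …): GPC strength and no mechanism on this line; one additive invariant of FormalRep vanishing on the moves and the Γ-pairs but separating a rational pair refutes it — and the summit.
sources: KontsevichZagier2001, HuberMullerStachPeriods2017, Ayoub2014, Andre2004, Brown2012
[crux] CONJECTURE 1 FOR THE Γ-ENLARGED CALCULUS — the complement of GammaHodgeSector, CLAIMED by
this route as its last-ranked crux (rev 7, route-choice (a): it replaces here the shared sup/closure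
item stmt-KontsevichZagierPeriods-10378, kept by MotivatedMoves, by the SUBGROUP form). For every
additive subgroup H of FormalRep with KZ.relations ≤ H that contains the difference [ρ] − [ρ'] of
every Deligne–Koblitz–Ogus Γ-Hodge pair — ρ the cube representation [(0,1)^N, Π
t_j^(x_j−1)(1−t_j)^(y_j−1)], ρ' the representation [unit 2k-ball × (0,1)^N', c·k!·Π(…)], under
exactly the hypotheses of GammaHodgeSector (positive non-integer rational exponents, the decidable
Hodge-type condition via Int.fract, c real algebraic, equal values) — and for all RATIONAL
representations r, r' (KZ.IntegralRep.IsRational, KZ §1.1 shape) of equal value: [r] − [r'] ∈ H.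
Equivalently [r] − [r'] ∈ relations ⊔ closure(Γ-Hodge pair differences) (take H = that subgroup;
conversely sup_le): the planner's Sketch.lean kernel-checks CompleteModGammaSector ↔
GammaSectorComplete and KontsevichZagierPeriods → CompleteModGammaSector (rc 0), so the crux is
summit-implied (never stronger than the summit) and with GammaHodg -/
@[route_item "route-KontsevichZagierPeriods-TerasomaMultiplication", crux]
def CompleteModGammaSector : Prop :=
  ∀ H : AddSubgroup Literature.NumberTheory.Transcendental.KZ.FormalRep, Literature.NumberTheory.Transcendental.KZ.relations ≤ H → (∀ (N N' k : ℕ) (x y : Fin N → ℚ) (x' y' : Fin N' → ℚ) (c : ℝ), (∀ j, 0 < x j ∧ 0 < y j ∧ Int.fract (x j) ≠ 0 ∧ Int.fract (y j) ≠ 0) → (∀ l, 0 < x' l ∧ 0 < y' l ∧ Int.fract (x' l) ≠ 0 ∧ Int.fract (y' l) ≠ 0) → (∀ u : ℕ, 0 < u → (∀ j, Nat.Coprime u (x j).den ∧ Nat.Coprime u (y j).den) → (∀ l, Nat.Coprime u (x' l).den ∧ Nat.Coprime u (y' l).den) → ((∑ j, (Int.fract ((u : ℚ) * x j) + Int.fract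 ((u : ℚ) * y j) - Int.fract ((u : ℚ) * (x j + y j)))) - ∑ l, (Int.fract ((u : ℚ) * x' l) + Int.fract ((u : ℚ) * y' l) - Int.fract ((u : ℚ) * (x' l + y' l)))) = (k : ℚ)) → IsAlgebraic ℚ c → ∀ (ρ : Literature.NumberTheory.Transcendental.KZ.IntegralRep N) (ρ' : Literature.NumberTheory.Transcendental.KZ.IntegralRep (2 * k + N')), ρ.domain = {t | ∀ j, t j ∈ Set.Ioo (0:ℝ) 1} → Set.EqOn ρ.integrand (fun t => ∏ j, (t j) ^ ((x j : ℝ) - 1) * (1 - t j) ^ ((y j : ℝ) - 1)) ρ.domain → ρ'.domain = {z | (∑ i : Fin (2 * k), (z (Fin.castAdd N' i)) ^ 2) < 1 ∧ ∀ l : Fin N', z (Fin.natAdd (2 * k) l) ∈ Set.Ioo (0:ℝ) 1} → Set.EqOn ρ'.integrand (fun z => c * (k.factorial : ℝ) * ∏ l, (z (Fin.natAdd (2 * k) l)) ^ ((x' l : ℝ) - 1) * (1 - z (Fin.natAdd (2 * k) l)) ^ ((y' l : ℝ) - 1)) ρ'.domain → ρ.value = ρ'.value → Literature.NumberTheory.Transcendental.KZ.of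 ρ - Literature.NumberTheory.Transcendental.KZ.of ρ' ∈ H) → ∀ ⦃n m : ℕ⦄ (r : Literature.NumberTheory.Transcendental.KZ.IntegralRep n) (r' : Literature.NumberTheory.Transcendental.KZ.IntegralRep m), r.IsRational → r'.IsRational → r.value = r'.value → Literature.NumberTheory.Transcendental.KZ.of r - Literature.NumberTheory.Transcendental.KZ.of r' ∈ H

/-- item stmt-KontsevichZagierPeriods-3598 · banked · rank 2 · closed · proved by Summit.KontsevichZagierPeriods.TerasomaMultiplication.MultiplicationThreeBolza.MultiplicationThree_proof (prover) · by planner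
why it might fail: No numerics-only step left: 2-torsion move = Möbius μ₁ with Q∘μ₁ = (μ₁′)²Q by `ring`; factor 3 = the simplex's cyclic symmetry. Residual risk formal: a₁(u) and the real cube root as ℚ-semialgebraic C¹ rule-(2) data, integrability of u^(s−1)/√Q on Σ_neg; a slip lengthens the chain, cannot kill it.
sources: OtsuboYamazaki2026, ShaskaVoelklein2001, Cassels1991, AndrewsAskeyRoy1999, DeinesEtAl2014, KontsevichZagier2001
[crux] n = 3, all rational s > 0: [∫∫_{(0,1)²} v_1^{−2/3}(1−v_1)^{s−1} v_2^{−1/3}(1−v_2)^{s−1}] ~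
[∫∫_{σ_1,σ_2>0, σ_1+σ_2<3} (σ_1σ_2(3−σ_1−σ_2))^{s−1}] (B(1/3,s)B(2/3,s) = 3^{3s−1}Γ(s)³/Γ(3s), e.g.
111.09287484 at s = 1/9). First non-real case of Terasoma's map (c_3 = i√3): exhibit Θ_3 ∈
ℤ[(μ_d×μ_3)² ⋊ S_2] and a semialgebraic 3-chain W_3 ⊂ C²(ℂ) ⊂ ℝ⁸ with ∂W_3 = Z_0 − Θ_3·γ² (mod
chains on which (x_1x_2)^{a−d}(y_2−y_1)dy_1dy_2 restricts to 0), then Stokes = three Newton–Leibniz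
moves with the form's coefficients as primitives, sheets as CoV, ζ_3-twists as (Re, Im) pairs.
[difficulty: L] -/
@[route_item "route-KontsevichZagierPeriods-TerasomaMultiplication"]
def MultiplicationThree : Prop :=
  ∀ s : ℚ, 0 < s → ∀ (r r' : Literature.NumberTheory.Transcendental.KZ.IntegralRep 2), r.domain = {x | ∀ i, x i ∈ Set.Ioo (0:ℝ) 1} → Set.EqOn r.integrand (fun x => (x 0) ^ (-(2:ℝ)/3) * (1 - x 0) ^ ((s:ℝ) - 1) * (x 1) ^ (-(1:ℝ)/3) * (1 - x 1) ^ ((s:ℝ) - 1)) r.domain → r'.domain = {x | 0 < x 0 ∧ 0 < x 1 ∧ x 0 + x 1 < 3} → Set.EqOn r'.integrand (fun x => (x 0 * x 1 * (3 - x 0 - x 1)) ^ ((s:ℝ) - 1)) r'.domain → Literature.NumberTheory.Transcendental.KZ.Equivalent r r'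

-- `MultiplicationThree` holds: proved by `Summit.KontsevichZagierPeriods.TerasomaMultiplication.MultiplicationThreeBolza.MultiplicationThree_proof` (its module imports this route file, so no `_holds` link can be stated here).

/-- item stmt-KontsevichZagierPeriods-12305 · banked · rank 3 · closed · proved by Summit.KontsevichZagierPeriods.TerasomaMultiplication.MultiplicationAccessible.MultiplicationAccessible_of @ 502e2e1c7329 (prover) · by planner
why it might fail: Torsion is closed and n = 2^k falls to the sieve, but no chain exists at any odd prime p ≥ 5: the sieve's x ≠ 1/p instances GM(p;x,s) are ratios of two Davenport–Hasse identities, classically reached only by cancelling ΠB(x,k/p) (crux 4); a direct W_p ⊂ ℝ^(4(p−1)) has no bounding theorem yet.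
sources: OtsuboYamazaki2026, Otsubo2023, arXiv:1901.03400, AndrewsAskeyRoy1999, KontsevichZagier2001, Terasoma1995
[crux] the whole pure-Beta multiplication family (card target; the retired route's X): for every m ≥
1 (n = m+1) and rational s > 0 the box rep of Π_(k=1..m) B(k/n, s) on (0,1)^m and the simplex rep
∫_(σ_j>0, Σσ_j<n) (Πσ_j·(n−Σσ_j))^(s−1) (value n^(ns−1)Γ(s)^n/Γ(ns); equal by Euler–Gauss, checked
to 1e-15 for n = 2..6) are KZ-equivalent — the period statement of O–Y Thm 7.2 INSIDE the rules,
uniformly in n: Θ_n ∈ ℤ[(μ_d×μ_n)^(n−1) ⋊ S_(n−1)] and W_n from a Rohrlich-type cyclicity of H_1(C,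
cusps; ℤ) over the group ring. [deps: MultiplicationThree] [difficulty: XL] -/
@[route_item "route-KontsevichZagierPeriods-TerasomaMultiplication", crux]
def MultiplicationAccessible : Prop :=
  ∀ (m : ℕ) (s : ℚ), 1 ≤ m → 0 < s → ∀ (r r' : Literature.NumberTheory.Transcendental.KZ.IntegralRep m), r.domain = {x | ∀ i, x i ∈ Set.Ioo (0:ℝ) 1} → Set.EqOn r.integrand (fun x => ∏ i : Fin m, (x i) ^ ((((i:ℕ):ℝ) + 1) / ((m:ℝ) + 1) - 1) * (1 - x i) ^ ((s:ℝ) - 1)) r.domain → r'.domain = {x | (∀ i, 0 < x i) ∧ ∑ i, x i < (m:ℝ) + 1} → Set.EqOn r'.integrand (fun x => ((∏ i, x i) * ((m:ℝ) + 1 - ∑ i, x i)) ^ ((s:ℝ) - 1)) r'.domain → Literature.NumberTheory.Transcendental.KZ.Equivalent r r'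

-- `MultiplicationAccessible` holds: proved by `Summit.KontsevichZagierPeriods.TerasomaMultiplication.MultiplicationAccessible.MultiplicationAccessible_of` @ 502e2e1c7329 (its module imports this route file, so no `_holds` link can be stated here).

-- earlier BetaCancellation (stmt-KontsevichZagierPeriods-12306, replaced 2026-08-15T19:49:41Z -> stmt-KontsevichZagierPeriods-13633): retired by None — ∀ (a b : ℚ), 0 < a → 0 < b → ∀ (β : Literature.NumberTheory.Transcendental.KZ.IntegralRep 1), β.domain = {x | x 0 ∈ Set.Ioo (0:ℝ) 1} → Set.EqOn β.integrand (fun x => (x 0) ^ ((a:ℝ) - 1) * (1 - x 0) ^ ((b:ℝ) - 1)) β.domain → ∀ c : Literature.NumberThe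
/-- item stmt-KontsevichZagierPeriods-13633 · aside · rank 4 · open · by planner
why it might fail: EQUIVALENT to item 0540 (tree thm betaCancellation_iff_ayoubPiCancellation): effective-period injectivity at [π], open in print (HuberWustholz2022 App. A.4; Ayoub2015 Rem. 1.3). HELD on 0540; closes by betaCancellation_of_ayoubPiCancellation h0540; ¬0540 (item 0542) refutes it and the summit.
sources: HuberWustholz2022, Ayoub2015, OtsuboYamazaki2026, KontsevichZagier2001, HuberMullerStachPeriods2017, arXiv:2208.05182
[crux] BETA-CANCELLATION — Beta classes are NON-ZERO-DIVISORS modulo the moves, stated in the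
import-free TWO-TERM form over KZCalculus (rev 4, cone repair 2026-08-15: the FormalRep form `KZ.of
β * c ∈ relations → c ∈ relations` needed the product of KZProduct, whose module cone carries the
open AyoubSpecialisation theses PiCancellation/PiLocalKernel; nothing here uses them). For positive
rationals a, b, representations r, r' of ANY dimensions n, m, and representations q : IntegralRep
(1+n), q' : IntegralRep (1+m) PINNED as 'Beta kernel ⊗ r', 'Beta kernel ⊗ r'' in the coordinate
convention of KZ.IntegralRep.prod (first coordinate z (Fin.castAdd n 0) = the Beta variable on
(0,1), last n coordinates fun j => z (Fin.natAdd 1 j) in r.domain; integrand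
x^(a−1)(1−x)^(b−1)·r.integrand(tail) on the domain): q ~ q' → r ~ r'. EQUIVALENT to the FormalRep
form by PROVED library facts only: KZ.exists_integralRep_sub_holds (every formal combination c ≡ [r]
− [r'] mod relations), KZ.mul_mem_relations_left_holds (left ideal), KZ.of_mul_of +
IntegralRep.prod_integrand_of / prodFunSemialgebraic_holds (β.prod r is such a q for any
(0,1)-representation β of B(a,b)), and KZ.of_sub_of_mem_relations_of_e -/
@[route_item "route-KontsevichZagierPeriods-TerasomaMultiplication", crux]
def BetaCancellation : Prop :=
  ∀ (a b : ℚ), 0 < a → 0 < b → ∀ ⦃n m : ℕ⦄ (r : Literature.NumberTheory.Transcendental.KZ.IntegralRep n) (r' : Literature.NumberTheory.Transcendental.KZ.IntegralRep m) (q : Literature.NumberTheory.Transcendental.KZ.IntegralRep (1 + n)) (q' : Literature.NumberTheory.Transcendental.KZ.IntegralRep (1 + m)), q.domain = {z | z (Fin.castAdd n 0) ∈ Set.Ioo (0:ℝ) 1 ∧ (fun j => z (Fin.natAdd 1 j)) ∈ r.domain} → Set.EqOn q.integrand (fun z => (z (Fin.castAdd n 0)) ^ ((a:ℝ) - 1)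 * (1 - z (Fin.castAdd n 0)) ^ ((b:ℝ) - 1) * r.integrand (fun j => z (Fin.natAdd 1 j))) q.domain → q'.domain = {z | z (Fin.castAdd m 0) ∈ Set.Ioo (0:ℝ) 1 ∧ (fun j => z (Fin.natAdd 1 j)) ∈ r'.domain} → Set.EqOn q'.integrand (fun z => (z (Fin.castAdd m 0)) ^ ((a:ℝ) - 1) * (1 - z (Fin.castAdd m 0)) ^ ((b:ℝ) - 1) * r'.integrand (fun j => z (Fin.natAdd 1 j))) q'.domain → Literature.NumberTheory.Transcendental.KZ.Equivalent q q' → Literature.NumberTheory.Transcendental.KZ.Equivalent r r'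

/-- item stmt-KontsevichZagierPeriods-13215 · banked · rank 6 · closed · proved by Summit.KontsevichZagierPeriods.TerasomaMultiplication.DasGapTwelve.dasGapTwelve_holds @ bcefa01e4496 (prover) · by planner
why it might fail: Mathematics settled in dimension one (3 of 5 stubs landed); residual risk is formal — the 2:1 quotient cells onto the unbounded target (√D,∞) need integrability via the Jacobian criterion and ℚ-semialgebraicity of nested radicals; a Neg-type invariant separating the pair would refute the summit.
sources: Das2000, KoblitzOgus1979, Deligne1982HodgeCycles, Gross1978, OtsuboYamazaki2026, HuberWustholz2022
[crux] THE SMALLEST YAMAMOTO–DAS GAP IDENTITY as a KZ pair (planner's exact lattice computation this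
session, num/gapgroup.py: the Koblitz–Ogus Hodge-type lattice H_N modulo the ℤ-span S_N of
reflection and multiplication vectors is 0 for N ≤ 30 except ℤ/2 at N = 12, 15, 20, 21, 24, 28, 30;
at N = 12 the class is a = [1/12] − [1/4] − [1/3], with 2a ∈ S_12 but a ∉ S_N' for N' = 12, 24, 36,
48, 60, 120; the N = 15 class is exactly Das's B(4/15,1/5) ∝ B(1/3,2/15) quoted by MotivatedMoves).
In Beta form it is the dimension-1 LINEAR pair B(1/12,1/4) = c₀·B(1/4,1/4), c₀ =
2^(−1/4)·3^(3/8)·√(1+√3) = 3^(3/8)·√(2cos(π/12)) = 2.0984921908 (classically Chowla–Selberg at d =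
−3, −4; both sides 15.5630449262 to 1e-15): [∫_0^1 x^(−11/12)(1−x)^(−3/4)] ~ [∫_0^1 c₀
(x(1−x))^(−3/4)]. The CM types agree (H_(1,3,8) = H_(3,3,6) = {1,5} in (ℤ/12)^×), so it is induced
by an isogeny between the (1,3,8) factor of J(F_12) and the lemniscatic curve y² = x³ − x
(Koblitz–Rohrlich/Shimura–Taniyama; an instance of FermatIsogeny's BetaLinearSector and of
MotivatedMoves' GammaHodgePairs) — but inside the calculus it is NOT reachable from
MultiplicationAccessible + reflection + translation + BetaCancellation (a ∉ S -/
@[route_item "route-KontsevichZagierPeriods-TerasomaMultiplication"]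
def DasGapTwelve : Prop :=
  ∀ (r r' : Literature.NumberTheory.Transcendental.KZ.IntegralRep 1), r.domain = {x | x 0 ∈ Set.Ioo (0:ℝ) 1} → Set.EqOn r.integrand (fun x => (x 0) ^ (-(11:ℝ)/12) * (1 - x 0) ^ (-(3:ℝ)/4)) r.domain → r'.domain = {x | x 0 ∈ Set.Ioo (0:ℝ) 1} → Set.EqOn r'.integrand (fun x => (2:ℝ) ^ (-(1:ℝ)/4) * (3:ℝ) ^ ((3:ℝ)/8) * Real.sqrt (1 + Real.sqrt 3) * (x 0) ^ (-(3:ℝ)/4) * (1 - x 0) ^ (-(3:ℝ)/4)) r'.domain → Literature.NumberTheory.Transcendental.KZ.Equivalent r r'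

-- `DasGapTwelve` holds: proved by `Summit.KontsevichZagierPeriods.TerasomaMultiplication.DasGapTwelve.dasGapTwelve_holds` @ bcefa01e4496 (its module imports this route file, so no `_holds` link can be stated here).

/-- item stmt-KontsevichZagierPeriods-0312 · support · rank 9 · open · by planner
sources: Deligne1982HodgeCycles, KontsevichZagier2001, OtsuboYamazaki2026
Positive form of #2. A proof must avoid Γ: candidate strategy = realise the degree-9 Fermat-curve
correspondence behind the identity as semialgebraic changes of variables between (blow-ups of)
(0,1)² pieces plus Newton–Leibniz with algebraic primitives (Rohrlich/Deligne distribution relations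
are induced by the maps x ↦ x³ on Fermat curves — algebraic, finite ⇒ CoV on injectivity cells). If
found, pressure point (b) of route Neg dies at its first instance. [elaborates: yes:
_survey/SketchB.lean; sources: Deligne1982HodgeCycles, KontsevichZagier2001] -/
@[route_item "route-KontsevichZagierPeriods-TerasomaMultiplication"]
def TriplicationAccessible : Prop :=
  ∀ (r r' : Literature.NumberTheory.Transcendental.KZ.IntegralRep 2), r.domain = {x | ∀ i, x i ∈ Set.Ioo (0:ℝ) 1} → Set.EqOn r.integrand (fun x => (x 0) ^ (-(8:ℝ)/9) * (1 - x 0) ^ (-(5:ℝ)/9) * (x 1) ^ (-(4:ℝ)/9) * (1 - x 1) ^ (-(2:ℝ)/9)) r.domain → r'.domain = {x | x 0 ^ 2 + x 1 ^ 2 < 4} → Set.EqOn r'.integrand (fun _ => (3:ℝ) ^ ((7:ℝ)/6) / 2) r'.domain → Literature.NumberTheory.Transcendental.KZ.Equivalent r r'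

/-- item stmt-KontsevichZagierPeriods-12307 · support · rank 9 · closed · proved by Summit.KontsevichZagierPeriods.KontsevichZagierPeriods.Theorems.reflectionThird_proof (prover) · by planner
sources: AndrewsAskeyRoy1999, KontsevichZagier2001
[support] reflection at 1/3 as a chain: sin(π/3)·B(1/3,2/3) = π, i.e. [∫_0^1 sin(π/3)
x^(−2/3)(1−x)^(−1/3) dx] ~ [closed unit disc, 1] — LITERALLY the instance a = 1/3 of
CompiledSubstitutions' EulerReflectionRational (stmt-KontsevichZagierPeriods-3383; one line from it
once that lands: ((1/3:ℚ):ℝ) − 1 = −2/3, −(1/3) = −1/3 by push_cast/norm_num inside the EqOn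
hypotheses), filed as the explicit instance so that the 0312 derivation does not wait on the ∀a
theorem. Paper chain: x = u³/(1+u³) gives 3 sin(π/3)∫_0^∞ du/(1+u³); fold (1,∞) onto (0,1) by u ↦
1/u before partial fractions over ℚ(√3); the log pieces cancel by symmetry, the arctan piece is a
rule-2 image of a disc sector (same device as FermatIsogeny's ReflectionNinth). [difficulty: M] -/
@[route_item "route-KontsevichZagierPeriods-TerasomaMultiplication"]
def ReflectionThird : Prop :=
  ∀ (r : Literature.NumberTheory.Transcendental.KZ.IntegralRep 1) (p : Literature.NumberTheory.Transcendental.KZ.IntegralRep 2), r.domain = {x | x 0 ∈ Set.Ioo (0:ℝ) 1} → Set.EqOn r.integrand (fun x => Real.sin (Real.pi / 3) * (x 0) ^ (-(2:ℝ)/3) * (1 - x 0) ^ (-(1:ℝ)/3)) r.domain → p.domain = {z | z 0 ^ 2 + z 1 ^ 2 ≤ 1} → Set.EqOn p.integrand (fun _ => 1) p.domain → Literature.NumberTheory.Transcendental.KZ.Equivalent r p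

-- `ReflectionThird` holds: proved by `Summit.KontsevichZagierPeriods.KontsevichZagierPeriods.Theorems.reflectionThird_proof` (its module imports this route file, so no `_holds` link can be stated here).

/-- item stmt-KontsevichZagierPeriods-12309 · support · rank 9 · closed · proved by Summit.KontsevichZagierPeriods.TerasomaMultiplication.DuplicationAllExponents.duplicationAllExponents_proof (prover) · by planner
sources: KontsevichZagier2001, AndrewsAskeyRoy1999, arXiv:1901.03400
[support] n = 2 calibration for every rational s > 0 (generalises LowDimension's
LowdimDuplicationOneThird): [∫_0^1 v^(−1/2)(1−v)^(s−1) dv] ~ [∫_0^2 (σ(2−σ))^(s−1) dσ] (B(1/2,s) =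
2^(2s−1)B(s,s)). Terasoma's map is real here: CoV σ = 1+y, domain additivity at y = 0 plus the fold
y ↦ −y (Θ_2 = 1 − η, W_2 = ∅), CoV v = y²: four moves; exercises the changeOfVariablesRel side
conditions (InjOn, HasFDerivWithinAt, IsSemialgebraicMapOn) every other item needs. [difficulty:
provable-now] -/
@[route_item "route-KontsevichZagierPeriods-TerasomaMultiplication"]
def DuplicationAllExponents : Prop :=
  ∀ s : ℚ, 0 < s → ∀ (r r' : Literature.NumberTheory.Transcendental.KZ.IntegralRep 1), r.domain = {x | x 0 ∈ Set.Ioo (0:ℝ) 1} → Set.EqOn r.integrand (fun x => (x 0) ^ (-(1:ℝ)/2) * (1 - x 0) ^ ((s:ℝ) - 1)) r.domain → r'.domain = {x | x 0 ∈ Set.Ioo (0:ℝ) 2} → Set.EqOn r'.integrand (fun x => (x 0 * (2 - x 0)) ^ ((s:ℝ) - 1)) r'.domain → Literature.NumberTheory.Transcendental.KZ.Equivalent r r'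

-- `DuplicationAllExponents` holds: proved by `Summit.KontsevichZagierPeriods.TerasomaMultiplication.DuplicationAllExponents.duplicationAllExponents_proof` (its module imports this route file, so no `_holds` link can be stated here).

-- earlier TriplicationFromMultiplication (stmt-KontsevichZagierPeriods-12308, replaced 2026-08-15T19:36:02Z -> stmt-KontsevichZagierPeriods-13693): retired by None — MultiplicationThree → BetaCancellation → ReflectionThird → TriplicationAccessible
/-- item stmt-KontsevichZagierPeriods-13693 · support · rank 9 · closed · proved by Summit.KontsevichZagierPeriods.TerasomaMultiplication.TriplicationGlue.triplicationFromMultiplication_proof (prover) · by planner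
sources: AndrewsAskeyRoy1999, KontsevichZagier2001, OtsuboYamazaki2026
[support] THE CANCELLATION GLUE (planner's ring derivation, every value checked to 1e-13): write
β(a,b) for the class of [(0,1), x^(a−1)(1−x)^(b−1)], L = β(1/9,4/9)β(5/9,7/9) (the 0312 rep), A =
β(1/3,1/9)β(2/3,1/9), S' = 3^(−2/3)β(1/9,1/9)β(2/9,1/9) (MultiplicationThree at s = 1/9 after one
scaling + Dirichlet CoV of the simplex side), ρ = β(1/3,2/3). (i) L·A ~ 3^(5/3)·ρ·S' by EIGHT
content-preserving moves in dimension 4 (Dirichlet re-association B(a,b)B(a+b,c) = B(b,c)B(a,b+c) —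
two rule-2 moves through the simplex, AndrewsAskeyRoy1999 Thm 1.8.1 — at (a,b,c) = (1/9,2/3,5/9),
(1/3,1/9,1/9), (1/3,2/9,2/3), (2/9,1/9,8/9) on the L·A side and (1/9,2/3,2/9) on the ρ·S' side;
translation β(1/9,11/9) = (2/3)β(1/9,2/9) and β(2/9,1) = 9/2 = Newton–Leibniz with monomial
primitives; both sides land on 3·β(1/9,1/9)β(1/9,8/9)β(2/9,2/3) = 2514.8236604); (ii) ρ ~ (2/√3)[π]
by ReflectionThird and scaling; (iii) S' ~ A by MultiplicationThree; hence (L − 2·3^(7/6)[π])·A ∈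
relations, and BetaCancellation applied to β(1/3,1/9) and β(2/3,1/9) gives L ~ 2·3^(7/6)[π]; (iv)
normalise the disc to radius 2 (rule 2, |det| = 4; boundary circle null). Products, ideal property,
commutativity and reindexing fr -/
@[route_item "route-KontsevichZagierPeriods-TerasomaMultiplication"]
def TriplicationFromMultiplication : Prop :=
  MultiplicationThree → ReflectionThird → BetaCancellation → TriplicationAccessible

-- `TriplicationFromMultiplication` holds: proved by `Summit.KontsevichZagierPeriods.TerasomaMultiplication.TriplicationGlue.triplicationFromMultiplication_proof` (its module imports this route file, so no `_holds` link can be stated here).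

/-- item stmt-KontsevichZagierPeriods-14675 · support · rank 9 · closed · proved by Summit.KontsevichZagierPeriods.TerasomaMultiplication.NegativeBranchToMaxCell.negativeBranchToMaxCell_proof (prover) · by planner
sources: Cassels1991, AndrewsAskeyRoy1999, KontsevichZagier2001, ShaskaVoelklein2001
[support] EXPLICIT STEP (iii) OF CRUX 2's BOLZA LINE (promote-to-A g2, 2026-08-16): for every
rational s > 0, [Σ_neg = {0<u<1, a<0}, u^(s−1)/√Q(a,u)] ~ [M₃ = {σ ∈ Δ : σ₃ > σ₁, σ₃ > σ₂},
(σ₁σ₂σ₃)^(s−1)], Q = a²(3−a)² − 4ua, σ₃ = 3−σ₁−σ₂ (coordinates: x 0 = u, x 1 = a on the left; x 0 =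
σ₁, x 1 = σ₂ on the right). TWO rule-(2) moves + transitivity: (1) the Möbius involution μ₁(a) =
(3−a₁)(a−a₁)/(2a+a₁−3), a₁(u) = the root in (0,1) of a(3−a)² = 4u — translation by the 2-torsion
point (a₁,0) of E_u : w² = Q (swaps 0↔a₁, a₂↔a₃) — applied fibrewise over u maps Σ_neg bijectively
onto {0<u<1, a₁(u) < a < b₁(u) = (3−a₁)/2} with |∂μ₁/∂a|/√Q(μ₁a,u) = 1/√Q(a,u), because
Q(μ₁a)·(2a+a₁−3)⁴ = 9(3−a₁)²(a₁−1)²·Q(a) identically (kernel-checked `mobius_jacobian_identity`,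
`hasDerivAt_mobius`, `Q_at_mirror_pos` in the promote-g2 Sketch.lean attached to stmt-3598); (2) the
shear S(σ₁,σ₂) = (σ₁σ₂σ₃, σ₁) restricted to M₃ (inside the sheet σ₂ < σ₃, where S is injective) is a
bijection onto the same set — its fibre is the arc of the level cubic from (a₁,b₁,b₁) [σ₂=σ₃] to
(b₁,a₁,b₁) [σ₁=σ₃], and (b₁,a₁,b₁) lies on σ₁σ₂σ₃ = u (`mirror_point_on_level`) — with Jacobian
|∂u/∂σ₂| = σ₁(σ₃−σ₂) = √Q(σ₁,u) (`shear_j -/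
@[route_item "route-KontsevichZagierPeriods-TerasomaMultiplication"]
def NegativeBranchToMaxCell : Prop :=
  ∀ s : ℚ, 0 < s → ∀ (r r' : Literature.NumberTheory.Transcendental.KZ.IntegralRep 2), r.domain = {x | 0 < x 0 ∧ x 0 < 1 ∧ x 1 < 0} → Set.EqOn r.integrand (fun x => (x 0) ^ ((s:ℝ) - 1) / Real.sqrt ((x 1) ^ 2 * (3 - x 1) ^ 2 - 4 * x 0 * x 1)) r.domain → r'.domain = {x | 0 < x 0 ∧ 0 < x 1 ∧ x 0 < 3 - x 0 - x 1 ∧ x 1 < 3 - x 0 - x 1} → Set.EqOn r'.integrand (fun x => (x 0 * x 1 * (3 - x 0 - x 1)) ^ ((s:ℝ) - 1)) r'.domain → Literature.NumberTheory.Transcendental.KZ.Equivalent r r'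

-- `NegativeBranchToMaxCell` holds: proved by `Summit.KontsevichZagierPeriods.TerasomaMultiplication.NegativeBranchToMaxCell.negativeBranchToMaxCell_proof` (its module imports this route file, so no `_holds` link can be stated here).

/-- item stmt-KontsevichZagierPeriods-14676 · support · rank 9 · closed · proved by Summit.KontsevichZagierPeriods.TerasomaMultiplication.SimplexToMaxCell.simplexToMaxCell_proof @ 4458c29930dc (prover) · by planner
sources: AndrewsAskeyRoy1999, KontsevichZagier2001
[support] for every rational s > 0, [Δ = {σ₁,σ₂ > 0, σ₁+σ₂ < 3}, g = (σ₁σ₂σ₃)^(s−1)] ~ [M₃ = {σ₃ >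
σ₁, σ₃ > σ₂}, 3g], σ₃ = 3−σ₁−σ₂: Δ = M₁ ∪ M₂ ∪ M₃ ∪ (three mirror segments, Lebesgue-null) — rule
(1a) twice plus null-set absorption (KZ.of_mem_relations_of_volume_eq_zero); the cyclic permutation
c(σ₁,σ₂) = (σ₂, 3−σ₁−σ₂) (affine, |det| = 1, g∘c = g: `cyclic_invariance`) maps M₁ = {σ₁ max} onto
M₃ and c² maps M₂ onto M₃ — rule (2) twice; [M₃,g] + [M₃,g] + [M₃,g] ~ [M₃,3g] by rule (1b) twice.
This is the 3-torsion translation of E_u (a fixed-point-free order-3 automorphism of every smooth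
level cubic σ₁σ₂σ₃ = u) acting LINEARLY on the simplex — the reason crux 2 needs no
torsion-translation formula. Pattern: the affine changeOfVariablesRel instances K, M, Φ of
Theorems/MultiplicationThree/Negative/Calibration*.lean. [difficulty: S, provable now] -/
@[route_item "route-KontsevichZagierPeriods-TerasomaMultiplication"]
def SimplexToMaxCell : Prop :=
  ∀ s : ℚ, 0 < s → ∀ (r r' : Literature.NumberTheory.Transcendental.KZ.IntegralRep 2), r.domain = {x | 0 < x 0 ∧ 0 < x 1 ∧ x 0 + x 1 < 3} → Set.EqOn r.integrand (fun x => (x 0 * x 1 * (3 - x 0 - x 1)) ^ ((s:ℝ) - 1)) r.domain → r'.domain = {x | 0 < x 0 ∧ 0 < x 1 ∧ x 0 < 3 - x 0 - x 1 ∧ x 1 < 3 - x 0 - x 1} → Set.EqOn r'.integrand (fun x => 3 * (x 0 * x 1 * (3 - x 0 - x 1)) ^ ((s:ℝ) - 1)) r'.domain → Literature.NumberTheory.Transcendental.KZ.Equivalent r r'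

-- `SimplexToMaxCell` holds: proved by `Summit.KontsevichZagierPeriods.TerasomaMultiplication.SimplexToMaxCell.simplexToMaxCell_proof` @ 4458c29930dc (its module imports this route file, so no `_holds` link can be stated here).

/-- item stmt-KontsevichZagierPeriods-14858 · support · rank 9 · open · by planner
why it might fail: Deligne Thm 7.18 inside the calculus for every non-standard Γ-class beyond level 12 (N = 15, 20, 21, 28, …; unboundedly many): each needs a new semialgebraic correspondence or a square-root principle of Conjecture-1 strength; an additive invariant separating one Das pair refutes it and the summit.
sources: Das2000, KoblitzOgus1979, Deligne1982HodgeCycles, OtsuboYamazaki2026, AndrewsAskeyRoy1999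
[support] THE RESIDUAL Γ-HODGE SECTOR — the route's two-layer plan for crux 5 made explicit
(route-repair 2026-08-16, unused-crux glue). GammaHodgeSector VERBATIM (same binders; same pinned
cube and 2k-ball×cube representations; same Hodge-type, algebraicity-of-c and equal-value
hypotheses) RESTRICTED to the data whose Beta-SYMBOL difference D := wordSym x y − wordSym x' y' −
k·[½,½] (Literature.NumberTheory.Transcendental.BetaSymbol: BSym = ℤ[ℚ×ℚ], [½,½] standing for the
2-ball) lies OUTSIDE RelSpan ⊔ ℤ·g₁₂ — written IMPORT-FREE over Mathlib's FreeAbelianGroup (ℚ × ℚ)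
(the route file imports only the Statement; the inline closure term is
Literature.NumberTheory.Transcendental.BetaSymbol.RelSpan VERBATIM after unfolding
RelSpan/relatorPairs/msym/bsym/multL/multR, and ∑ j, of (x j, y j) is BetaSymbol.wordSym x y),
RelSpan being the span of the standard relator pairs (symmetry, translation, Dirichlet
re-association, pure-Beta Gauss multiplication multL/multR, Euler reflection, unit) and g₁₂ :=
[1/12,1/4] − [1/4,1/4] is the symbol of the DasGapTwelve pair (crux 6). By Koblitz–Ogus
(KoblitzOgus.hodge_eq_combination_int, PROVED in the tree) and the kernel of the class-vector map
clD (sy -/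
@[route_item "route-KontsevichZagierPeriods-TerasomaMultiplication"]
def GapSectorBeyondTwelve : Prop :=
  ∀ (N N' k : ℕ) (x y : Fin N → ℚ) (x' y' : Fin N' → ℚ) (c : ℝ), (∀ j, 0 < x j ∧ 0 < y j ∧ Int.fract (x j) ≠ 0 ∧ Int.fract (y j) ≠ 0) → (∀ l, 0 < x' l ∧ 0 < y' l ∧ Int.fract (x' l) ≠ 0 ∧ Int.fract (y' l) ≠ 0) → (∀ u : ℕ, 0 < u → (∀ j, Nat.Coprime u (x j).den ∧ Nat.Coprime u (y j).den) → (∀ l, Nat.Coprime u (x' l).den ∧ Nat.Coprime u (y' l).den) → ((∑ j, (Int.fract ((u : ℚ) * x j) + Int.fract ((u : ℚ) * y j) - Int.fract ((u : ℚ) * (x j + y j)))) - ∑ l, (Int.fract ((u : ℚ) * x' l) + Int.fract ((u : ℚ) * y' l) - Int.fract ((u : ℚ) * (x' l + y' l)))) = (k : ℚ)) → IsAlgebraic ℚ c → ((∑ j, FreeAbelianGroup.of (x j, y j)) - (∑ l, FreeAbelianGroup.of (x' l, y' l)) - k • FreeAbelianGroup.of (((1:ℚ)/2), ((1:ℚ)/2)))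 ∉ AddSubgroup.closure ((fun p : Multiset (ℚ × ℚ) × Multiset (ℚ × ℚ) => (p.1.map fun q : ℚ × ℚ => FreeAbelianGroup.of (q.1, q.2)).sum - (p.2.map fun q : ℚ × ℚ => FreeAbelianGroup.of (q.1, q.2)).sum) '' ({p : Multiset (ℚ × ℚ) × Multiset (ℚ × ℚ) | ∃ a b : ℚ, 0 < a ∧ 0 < b ∧ p = ({(a, b)}, {(b, a)})} ∪ {p | ∃ a b : ℚ, 0 < a ∧ 0 < b ∧ p = ({(a, b)}, {(a + 1, b)})} ∪ {p | ∃ a b c : ℚ, 0 < a ∧ 0 < b ∧ 0 < c ∧ p = ({(a, b), (a + b, c)}, {(b, c), (a, b + c)})} ∪ {p | ∃ (n : ℕ) (s : ℚ), 2 ≤ n ∧ 0 < s ∧ p = ((Finset.range (n - 1)).val.map fun k => ((((k + 1 : ℕ) : ℚ)) / n, s), (Finset.range (n - 1)).val.map fun j => (s, ((j + 1 : ℕ) : ℚ) * s))} ∪ {p | ∃ a : ℚ, 0 < a ∧ a < 1 ∧ p = ({(a, 1 - a)}, {(1 / 2, 1 / 2)})} ∪ {({((1 : ℚ), (1 : ℚ))},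 0)})) ⊔ AddSubgroup.zmultiples (FreeAbelianGroup.of (((1:ℚ)/12), ((1:ℚ)/4)) - FreeAbelianGroup.of (((1:ℚ)/4), ((1:ℚ)/4))) → ∀ (r : Literature.NumberTheory.Transcendental.KZ.IntegralRep N) (r' : Literature.NumberTheory.Transcendental.KZ.IntegralRep (2 * k + N')), r.domain = {t | ∀ j, t j ∈ Set.Ioo (0:ℝ) 1} → Set.EqOn r.integrand (fun t => ∏ j, (t j) ^ ((x j : ℝ) - 1) * (1 - t j) ^ ((y j : ℝ) - 1)) r.domain → r'.domain = {z | (∑ i : Fin (2 * k), (z (Fin.castAdd N' i)) ^ 2) < 1 ∧ ∀ l : Fin N', z (Fin.natAdd (2 * k) l) ∈ Set.Ioo (0:ℝ) 1} → Set.EqOn r'.integrand (fun z => c * (k.factorial : ℝ) * ∏ l, (z (Fin.natAdd (2 * k) l)) ^ ((x' l : ℝ) - 1) * (1 - z (Fin.natAdd (2 * k) l)) ^ ((y' l : ℝ) - 1)) r'.domain → r.value = r'.value → Literature.NumberTheory.Transcendental.KZ.Equivalent r r'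

-- earlier GammaHodgeFromRelators (stmt-KontsevichZagierPeriods-14859, replaced 2026-08-16T06:48:08Z -> stmt-KontsevichZagierPeriods-14921): retired by None — MultiplicationAccessible → BetaCancellation → DasGapTwelve → GapSectorBeyondTwelve → (∀ a : ℚ, 0 < a → a < 1 → ∀ (r : Literature.NumberTheory.Transcendental.KZ.IntegralRep 1) (p : Literature.NumberTheory.Transcendental.KZ.IntegralRep 2), r.doma
-- earlier GammaHodgeFromRelators (stmt-KontsevichZagierPeriods-14921, replaced 2026-08-16T06:50:31Z -> stmt-KontsevichZagierPeriods-14947): retired by None — MultiplicationAccessible → BetaCancellation → DasGapTwelve → GapSectorBeyondTwelve → GammaHodgeSector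
/-- item stmt-KontsevichZagierPeriods-14947 · support · rank 9 · closed · proved by Summit.KontsevichZagierPeriods.TerasomaMultiplication.GammaHodgeFromRelators.gammaHodgeFromRelators_proof (prover) · by planner
sources: AndrewsAskeyRoy1999, Deligne1982HodgeCycles, KoblitzOgus1979, Das2000, KontsevichZagier2001
[support] GLUE — THE RELATOR COMPILER (route-repair 2026-08-16, unused-crux: connects cruxes 3
MultiplicationAccessible, 4 BetaCancellation, 6 DasGapTwelve to the `closes` hypothesis
GammaHodgeSector = crux 5; this IS the route's two-layer plan 'StandardSpanAccessible → DasGapPairs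
→ GammaHodgeSector' as one typed implication): MultiplicationAccessible → BetaCancellation →
DasGapTwelve → GapSectorBeyondTwelve → (v) → GammaHodgeSector, where hypothesis (v) is Euler
reflection at rational arguments INLINED VERBATIM = CompiledSubstitutions' crux
stmt-KontsevichZagierPeriods-3383 EulerReflectionRational ([sin(πa)·x^(a−1)(1−x)^(−a) on (0,1)] ~
[closed unit disc, 1], 0 < a < 1; the 15-item cap forbids wanting it as a 16th item, and as an
explicit hypothesis the glue is PROVABLE NOW instead of blocked on 3383). STATUS (rev 24): an
ORDINARY SUPPORT ITEM TO BE PROVED — `closes` stays crux-only (GammaHodgeSector →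
CompleteModGammaSector → Statement, gate policy glue.non-crux-hypothesis); cruxes 3, 4, 6 feed the
closes hypothesis GammaHodgeSector through THIS item's statement; once it, the residual and 3383 are
theorems a planner may invoke them inside `closes`. PROOF PLAN (no open mathematic -/
@[route_item "route-KontsevichZagierPeriods-TerasomaMultiplication"]
def GammaHodgeFromRelators : Prop :=
  MultiplicationAccessible → BetaCancellation → DasGapTwelve → GapSectorBeyondTwelve → (∀ a : ℚ, 0 < a → a < 1 → ∀ (r : Literature.NumberTheory.Transcendental.KZ.IntegralRep 1) (p : Literature.NumberTheory.Transcendental.KZ.IntegralRep 2), r.domain = {x | x 0 ∈ Set.Ioo (0:ℝ) 1} → Set.EqOn r.integrand (fun x => Real.sin (Real.pi * a) * (x 0) ^ ((a : ℝ) - 1) * (1 - x 0) ^ (-(a : ℝ))) r.domain → p.domain = {z | z 0 ^ 2 + z 1 ^ 2 ≤ 1} → Set.EqOn p.integrand (fun _ => 1) p.domain → Literature.NumberTheory.Transcendental.KZ.Equivalent r p) → GammaHodgeSector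

-- `GammaHodgeFromRelators` holds: proved by `Summit.KontsevichZagierPeriods.TerasomaMultiplication.GammaHodgeFromRelators.gammaHodgeFromRelators_proof` (its module imports this route file, so no `_holds` link can be stated here).

-- earlier Assembly (stmt-KontsevichZagierPeriods-10444, replaced 2026-08-16T03:09:24Z -> stmt-KontsevichZagierPeriods-14232): retired by None — GammaHodgeSector → GammaSectorComplete → KontsevichZagierPeriods
/-- item stmt-KontsevichZagierPeriods-14232 · assembly · rank 1 · closed · proved by Summit.KontsevichZagierPeriods.Theorems.TerasomaMultiplicationAssembly.assembly_proof @ 7316e893a8d1 (prover) · by planner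
sources: KontsevichZagier2001, HuberMullerStachPeriods2017
[assembly] GammaHodgeSector → CompleteModGammaSector → the sub-problem statement: the Γ-Hodge sector
(every Deligne–Koblitz–Ogus pair difference lies in relations) plus Conjecture 1 for the Γ-enlarged
calculus (every relations-containing subgroup holding those differences holds all rational
equal-value differences) give Conjecture 1; the deciding theorem `closes` proves exactly this
implication (rev 7 replaces the rev-1 GammaHodgeSector → GammaSectorComplete → summit). -/
@[route_item "route-KontsevichZagierPeriods-TerasomaMultiplication"]
def Assembly : Prop :=
  GammaHodgeSector → CompleteModGammaSector → KontsevichZagierPeriods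

-- `Assembly` holds: proved by `Summit.KontsevichZagierPeriods.Theorems.TerasomaMultiplicationAssembly.assembly_proof` @ 7316e893a8d1 (its module imports this route file, so no `_holds` link can be stated here).

/-! D-0027 §2.1 — DECIDING THEOREM (planner-authored via `route open/edit --closes-file`; by planner-rrepair-KontsevichZagierPeriods-Teraso-e1efbcf7-0 2026-08-16T06:50:31Z):
its hypotheses are this route's items and its conclusion the sub-problem Statement (glue_lint), and it elaborates with this file. -/

@[closes "route-KontsevichZagierPeriods-TerasomaMultiplication"] theorem closes (h₁ : GammaHodgeSector) (h₂ : CompleteModGammaSector) : KontsevichZagierPeriods := by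
  intro n m r r' hr hr' hv
  exact h₂ _ le_rfl (fun N N' k x y x' y' c hx hx' hu hc ρ ρ' hd hi hd' hi' hval =>
    h₁ N N' k x y x' y' c hx hx' hu hc ρ ρ' hd hi hd' hi' hval) r r' hr hr' hv

end Summit.KontsevichZagierPeriods.KontsevichZagierPeriods.Theses.TerasomaMultiplication
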